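import Literature.AnabelianGeometry.SemiGraphs.PreimageComponentGluing
import Literature.AnabelianGeometry.Anabelioids.ConnectedOfTransitive
import HarnessLib

/-!
# Section fibres of a pulled-back object along a covering of semi-graphs of anabelioids — local lemmas
# ([SemiAnbd] §2, proof of Cor. 2.7 (i) p. 30; Rem. 2.2.1 p. 24)

Mochizuki, *Semi-graphs of anabelioids*, Publ. RIMS **42** (2006), §2, proof of Corollary 2.7 (i),
author's manuscript p. 30 ("`ℋ′` injects into `𝒢′` as a subgraph": along the finite étale covering
`𝒢′ → 𝒢` attached to `A`, the components of the restriction to `ℍ` are the coverings of `𝒢_ℍ` attached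
to the components of `A|_ℍ`) [cite: MochizukiSemiAnbd2006, Cor. 2.7(i) p.30]; Remark 2.2.1 p. 24
(images of fundamental groups are stabilisers).

PROOF-ONLY tool-kit (abc-iut cell, layer L3, gap row G-L3-R1-E3 «(Surj) under branch alignment»,
abc-iut-L3-d3; part A of the sheet argument for SECTION FIBRES).  For a morphism `φ : 𝒢′ → 𝒢`, an
object `Y` over `A` and a section `s : T → φ^* A` (`T` with terminal constituents), the *section fibre*
of `φ^* Y` at a vertex `w′ ↦ u` inside a sub-object `c ↪ Y_u` is the pull-back
`Ψ_c := φ_{w′}^*(c) ×_{φ_{w′}^* A_u} T_{w′}` — the points of `c` lying over the section point.  This file: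

* `factors_iff_of_gluing_sub` — **gluing squares transport factorisations** (the tree's
  `factors_iff_of_gluing_component`, abc-iut-w5-d041, with "connected component of `A|_ℍ`" generalised
  to "any morphism from a connected object into any `V ∈ B(𝒳)`"): for a sub-object `n : W ↪ V`, a
  branch `β` at `ω`, `a : P → V_ω` and `q : Q → V_{ε}` from connected objects with
  `F(q) ⊆ F(β^* a ≫ ψ_β^V)`, `a` factors through `n_ω` iff `q` factors through `n_ε`;
* `sectionFibre_transitive` — **the section fibre `Ψ_c` of a CONNECTED `c` is a transitive
  `Π_{w′}`-set as soon as `Stab_{Π_u}(x_{w′}) ≤ ι_{w′}(Π_{w′})`** (vertex alignment at the section point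
  `x_{w′}`, Rem. 2.2.1): two points of `c` over `x` differ by an element of `Stab(x)`;
* `isConnected_sectionFibre`, `exists_hom_sectionFibre_of_mem_range` — hence `Ψ_c` is connected
  (when non-empty) and a sub-object of `φ_{w′}^* Y_u` meeting it contains it.

No definition (the section fibre is a `pullback` term); nothing here takes a side on [IUTchIII]
Cor. 3.12.
-/

namespace Literature.AnabelianGeometry.SemiGraphs

open CategoryTheory CategoryTheory.Limits CategoryTheory.PreGaloisCategory
open Literature.AnabelianGeometry.Anabelioids

universe w v₁ u₁ u

namespace SemiGraphOfAnabelioids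

variable {𝒳 : SemiGraphOfAnabelioids.{v₁, u₁, u}}

/-! ### Gluing squares transport factorisations (general form) -/

/-- **Factorisations correspond along a gluing square.**  Let `n : W ↪ V` be a monomorphism of
`B(𝒳)`, `β` a branch of the edge `ε` abutting to the vertex `ω`, `a : P → V_ω` and `q : Q → V_ε`
morphisms from CONNECTED objects such that the fibre-image of `q` lies in that of `β^* a` followed by
the gluing `ψ_β : β^* V_ω ⥲ V_ε` of `V`.  Then `a` factors through `n_ω` iff `q` factors through `n_ε`
(read both on the fibre functors `β^* ⋙ F_ε`, `F_ε` through the gluing square of `n` at `β` and lift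
with `exists_hom_of_map_mem_range`).  The tree's `factors_iff_of_gluing_component` is the case
`V = A|_ℍ`, `P`, `Q` connected components. [cite: MochizukiSemiAnbd2006, Cor. 2.7(i) p.30] -/
theorem factors_iff_of_gluing_sub {V W : 𝒳.BObj} (n : W ⟶ V) [Mono n]
    (β : 𝒳.graph.Branch) (ω : 𝒳.graph.Vertex) (h : 𝒳.graph.abuts β = some ω)
    {P : 𝒳.V ω} [PreGaloisCategory.IsConnected P] (a : P ⟶ V.S ω)
    {Q : 𝒳.E (𝒳.graph.edgeOf β)} [PreGaloisCategory.IsConnected Q] (q : Q ⟶ V.T (𝒳.graph.edgeOf β))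
    (Fe : 𝒳.E (𝒳.graph.edgeOf β) ⥤ FintypeCat.{v₁}) [FiberFunctor Fe]
    (hPQ : Set.range (Fe.map q) ⊆
      Set.range (Fe.map ((𝒳.pull β ω h).pullback.map a ≫ (V.ψ β ω h).hom))) :
    (∃ f : P ⟶ W.S ω, f ≫ n.fS ω = a) ↔
      ∃ g : Q ⟶ W.T (𝒳.graph.edgeOf β), g ≫ n.fT (𝒳.graph.edgeOf β) = q := by
  -- the fibre functor `β^* ⋙ F_ε` of `𝒳_ω`
  let Pb := (𝒳.pull β ω h).pullback
  haveI : PreservesFiniteLimits Pb := (𝒳.pull β ω h).property.1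
  haveI : PreservesFiniteColimits Pb := (𝒳.pull β ω h).property.2
  let F' : 𝒳.V ω ⥤ FintypeCat.{v₁} := Pb ⋙ Fe
  haveI : FiberFunctor F' := fiberFunctor_comp_of_exact _ _
  let WS : 𝒳.V ω := W.S ω
  let WT : 𝒳.E (𝒳.graph.edgeOf β) := W.T (𝒳.graph.edgeOf β)
  let nW : WS ⟶ V.S ω := n.fS ω
  let nT : WT ⟶ V.T (𝒳.graph.edgeOf β) := n.fT (𝒳.graph.edgeOf β)
  haveI : Mono nW := 𝒳.mono_fS n ω
  haveI : Mono nT := 𝒳.mono_fT n (𝒳.graph.edgeOf β)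
  let ψV : Pb.obj (V.S ω) ≅ V.T (𝒳.graph.edgeOf β) := V.ψ β ω h
  let ψW : Pb.obj WS ≅ WT := W.ψ β ω h
  have hsq : Pb.map nW ≫ ψV.hom = ψW.hom ≫ nT := n.comm β ω h
  have hsq' : ∀ z', Fe.map ψV.hom (Fe.map (Pb.map nW) z') = Fe.map nT (Fe.map ψW.hom z') := by
    intro z'
    have e1 : Fe.map (Pb.map nW ≫ ψV.hom) = Fe.map (Pb.map nW) ≫ Fe.map ψV.hom := Fe.map_comp _ _
    have e2 : Fe.map (ψW.hom ≫ nT) = Fe.map ψW.hom ≫ Fe.map nT := Fe.map_comp _ _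
    have := ConcreteCategory.congr_hom (e1.symm.trans ((congrArg Fe.map hsq).trans e2)) z'
    simpa only [FintypeCat.comp_apply] using this
  have hVψ : ∀ y, Fe.map ψV.inv (Fe.map ψV.hom y) = y := fun y =>
    FintypeCat.hom_inv_id_apply (Fe.mapIso ψV) y
  have hVψ' : ∀ x, Fe.map ψV.hom (Fe.map ψV.inv x) = x := fun x =>
    FintypeCat.inv_hom_id_apply (Fe.mapIso ψV) x
  have hWψ' : ∀ z, Fe.map ψW.hom (Fe.map ψW.inv z) = z := fun z =>
    FintypeCat.inv_hom_id_apply (Fe.mapIso ψW) z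
  -- the fibre-image of `n_ε` is `ψ_β` of the fibre-image of `β^* n_ω`
  have hrange_n : ∀ x : Fe.obj (V.T (𝒳.graph.edgeOf β)),
      x ∈ Set.range (Fe.map nT) ↔ Fe.map ψV.inv x ∈ Set.range (Fe.map (Pb.map nW)) := by
    intro x
    constructor
    · rintro ⟨z, rfl⟩
      refine ⟨Fe.map ψW.inv z, ?_⟩
      calc Fe.map (Pb.map nW) (Fe.map ψW.inv z)
          = Fe.map ψV.inv (Fe.map ψV.hom (Fe.map (Pb.map nW) (Fe.map ψW.inv z))) := (hVψ _).symm
        _ = Fe.map ψV.inv (Fe.map nT (Fe.map ψW.hom (Fe.map ψW.inv z))) := by rw [hsq']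
        _ = Fe.map ψV.inv (Fe.map nT z) := by rw [hWψ']
    · rintro ⟨z', hz'⟩
      refine ⟨Fe.map ψW.hom z', ?_⟩
      calc Fe.map nT (Fe.map ψW.hom z') = Fe.map ψV.hom (Fe.map (Pb.map nW) z') := (hsq' z').symm
        _ = Fe.map ψV.hom (Fe.map ψV.inv x) := by rw [hz']
        _ = x := hVψ' x
  -- the position hypothesis, read through `ψ_β⁻¹`
  have hPQ' : ∀ x, x ∈ Set.range (Fe.map q) → Fe.map ψV.inv x ∈ Set.range (F'.map a) := fun x hx =>
    (mem_range_map_comp_iso_iff Fe (Pb.map a) ψV x).mp (hPQ hx)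
  obtain ⟨q₀⟩ := nonempty_fiber_of_isConnected Fe Q
  obtain ⟨p, hp⟩ := hPQ' (Fe.map q q₀) ⟨q₀, rfl⟩
  constructor
  · rintro ⟨f, hf⟩
    have hfp : F'.map nW (F'.map f p) = F'.map a p := by
      have e1 : F'.map (f ≫ nW) = F'.map f ≫ F'.map nW := F'.map_comp _ _
      have hf' : f ≫ nW = a := hf
      have := ConcreteCategory.congr_hom e1 p
      rw [hf'] at this
      simpa only [FintypeCat.comp_apply] using this.symm
    have hx : Fe.map q q₀ ∈ Set.range (Fe.map nT) := by
      rw [hrange_n, ← hp]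
      exact ⟨F'.map f p, hfp⟩
    exact exists_hom_of_map_mem_range Fe q nT hx
  · rintro ⟨g, hg⟩
    have hgq : Fe.map nT (Fe.map g q₀) = Fe.map q q₀ := by
      have e1 : Fe.map (g ≫ nT) = Fe.map g ≫ Fe.map nT := Fe.map_comp _ _
      have hg' : g ≫ nT = q := hg
      have := ConcreteCategory.congr_hom e1 q₀
      rw [hg'] at this
      simpa only [FintypeCat.comp_apply] using this.symm
    have hx : Fe.map q q₀ ∈ Set.range (Fe.map nT) := ⟨Fe.map g q₀, hgq⟩
    have hp' : F'.map a p ∈ Set.range (F'.map nW) := by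
      rw [hp]
      exact (hrange_n _).mp hx
    exact exists_hom_of_map_mem_range F' a nW hp'

end SemiGraphOfAnabelioids

end Literature.AnabelianGeometry.SemiGraphs

/-! ### Section fibres along an exact functor: transitivity, connectedness, lifting -/

namespace Literature.AnabelianGeometry.Anabelioids

open CategoryTheory CategoryTheory.Limits CategoryTheory.PreGaloisCategory

universe u₁ u₂ u₃ u₄ w

section SectionFibre

variable {C : Type u₁} [Category.{u₂} C] {D : Type u₃} [Category.{u₄} D]

/-- The fibre functor intertwines the `Aut F`-actions on fibres (naturality).
[cite: MochizukiGeoAn2004, Def. 1.1.2(ii) p.10] -/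
private theorem map_smul_aut₃ (F : D ⥤ FintypeCat.{w}) {P X : D} (f : P ⟶ X) (σ : Aut F)
    (p : F.obj P) : F.map f (σ • p) = σ • F.map f p := by
  simp only [mulAction_def]
  exact (FunctorToFintypeCat.naturality F F σ.hom f p).symm

/-- Transport along an isomorphism of basepoints commutes with the actions on fibres.
[cite: MochizukiGeoAn2004, §1.1 p.10] -/
private theorem autMulEquivOfIso_smul_hom_app' {Φ₁ Φ₂ : C ⥤ FintypeCat.{w}} (e : Φ₁ ≅ Φ₂) (X : C)
    (σ : Aut Φ₁) (x : Φ₁.obj X) : Aut.autMulEquivOfIso e σ • e.hom.app X x = e.hom.app X (σ • x) := by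
  rw [mulAction_def, mulAction_def]
  change (e.inv ≫ σ.hom ≫ e.hom).app X (e.hom.app X x) = _
  simp only [NatTrans.comp_app, FintypeCat.comp_apply]
  rw [← FintypeCat.comp_apply (e.hom.app X) (e.inv.app X), ← NatTrans.comp_app, e.hom_inv_id,
    NatTrans.id_app, FintypeCat.id_apply]

variable [GaloisCategory D]

/-- The first coordinate of a point of the section fibre lies over the section point.
[cite: MochizukiSemiAnbd2006, Rem. 2.2.1 p.24] -/
private theorem map_fst_sectionFibre (FD : D ⥤ FintypeCat.{w}) {cD AD T : D} (g : cD ⟶ AD)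
    (s : T ⟶ AD) (t : FD.obj T) [Subsingleton (FD.obj T)] (κ : FD.obj (pullback g s)) :
    FD.map g (FD.map (pullback.fst g s) κ) = FD.map s t := by
  rw [← FintypeCat.comp_apply, ← FD.map_comp, pullback.condition, FD.map_comp,
    FintypeCat.comp_apply]
  congr 1
  exact Subsingleton.elim _ _

/-- Points of a pull-back with the same two coordinates are equal (the fibre functor preserves the
pull-back). [cite: MochizukiSemiAnbd2006, Rem. 2.2.1 p.24] -/
private theorem ext_of_map_fst_snd (FD : D ⥤ FintypeCat.{w}) [FiberFunctor FD] {cD AD T : D} (g : cD ⟶ AD)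
    (s : T ⟶ AD) (κ κ' : FD.obj (pullback g s))
    (h1 : FD.map (pullback.fst g s) κ = FD.map (pullback.fst g s) κ')
    (h2 : FD.map (pullback.snd g s) κ = FD.map (pullback.snd g s) κ') : κ = κ' := by
  revert h1 h2
  obtain ⟨⟨⟨p1, p2⟩, hp⟩, rfl⟩ := (fiberPullbackEquiv FD g s).symm.surjective κ
  obtain ⟨⟨⟨p1', p2'⟩, hp'⟩, rfl⟩ := (fiberPullbackEquiv FD g s).symm.surjective κ'
  intro h1 h2
  simp only [fiberPullbackEquiv_symm_fst_apply, fiberPullbackEquiv_symm_snd_apply] at h1 h2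
  subst h1
  subst h2
  rfl

/-- **Points of a section fibre.**  For `Φ : C ⥤ D`, a basepoint `F_D` of `D`, morphisms
`ι : c ⟶ Y`, `f : Y ⟶ A` of `C` and a "section" `s : T ⟶ Φ A` with `F_D(T) = {t}`: a point `η` of
`F_D(Φ Y)` lies in the fibre-image of the section fibre `Ψ_c := Φ c ×_{Φ A} T → Φ c → Φ Y` iff it lies
in the fibre-image of `Φ ι` and over the section point `F_D(s) t`.
[cite: MochizukiSemiAnbd2006, Rem. 2.2.1 p.24] -/
theorem mem_range_sectionFibre_iff (Φ : C ⥤ D) (FD : D ⥤ FintypeCat.{w}) [FiberFunctor FD]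
    {c Y A : C} (ι : c ⟶ Y) (f : Y ⟶ A) {T : D} (s : T ⟶ Φ.obj A) (t : FD.obj T)
    [Subsingleton (FD.obj T)] (η : FD.obj (Φ.obj Y)) :
    η ∈ Set.range (FD.map (pullback.fst (Φ.map (ι ≫ f)) s ≫ Φ.map ι)) ↔
      η ∈ Set.range (FD.map (Φ.map ι)) ∧ FD.map (Φ.map f) η = FD.map s t := by
  constructor
  · rintro ⟨κ, rfl⟩
    refine ⟨⟨FD.map (pullback.fst (Φ.map (ι ≫ f)) s) κ, by rw [FD.map_comp, FintypeCat.comp_apply]⟩,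
      ?_⟩
    rw [FD.map_comp, FintypeCat.comp_apply, ← FintypeCat.comp_apply (FD.map (Φ.map ι)) (FD.map (Φ.map f)),
      ← FD.map_comp, ← Φ.map_comp]
    exact map_fst_sectionFibre FD (Φ.map (ι ≫ f)) s t κ
  · rintro ⟨⟨a, rfl⟩, hx⟩
    have ha : FD.map (Φ.map (ι ≫ f)) a = FD.map s t := by
      rw [Φ.map_comp, FD.map_comp, FintypeCat.comp_apply]
      exact hx
    refine ⟨(fiberPullbackEquiv FD (Φ.map (ι ≫ f)) s).symm ⟨(a, t), ha⟩, ?_⟩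
    rw [FD.map_comp, FintypeCat.comp_apply, fiberPullbackEquiv_symm_fst_apply]

variable [GaloisCategory C]

/-- **The section fibre of a connected object is a transitive `Π`-set under vertex alignment.**
Let `Φ : C ⥤ D` be a functor between Galois categories, `F_D` a basepoint of `D`,
`F_C` a basepoint of `C` with `e : Φ ⋙ F_D ≅ F_C`, `ι_Φ := Aut(e) ∘ π₁(Φ) : Aut F_D → Aut F_C`; let
`ι : c ⟶ Y`, `f : Y ⟶ A` in `C` with `c` CONNECTED, `s : T ⟶ Φ A` with `F_D(T) = {t}` and
`x := e(F_D(s) t) ∈ F_C(A)` the section point.  If `Stab_{Aut F_C}(x) ≤ ι_Φ(Aut F_D)` ([SemiAnbd]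
Rem. 2.2.1: the image of `Π_{w′}` in `Π_u` IS the stabiliser of the base point — vertex alignment),
then `Aut F_D` acts transitively on the fibre of the section fibre `Ψ_c = Φ c ×_{Φ A} T`: two points
of `c` over `x` differ by an element of `Stab(x)`. [cite: MochizukiSemiAnbd2006, Rem. 2.2.1 p.24] -/
theorem sectionFibre_isPretransitive (Φ : C ⥤ D) (FD : D ⥤ FintypeCat.{w}) [FiberFunctor FD]
    (FC : C ⥤ FintypeCat.{w}) [FiberFunctor FC] (e : Φ ⋙ FD ≅ FC)
    {c Y A : C} [IsConnected c] (ι : c ⟶ Y) (f : Y ⟶ A) {T : D} (s : T ⟶ Φ.obj A) (t : FD.obj T)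
    [Subsingleton (FD.obj T)]
    (hVA : MulAction.stabilizer (Aut FC) (e.hom.app A (FD.map s t)) ≤
      ((Aut.autMulEquivOfIso e).toMonoidHom.comp (pi1Map Φ FD)).range) :
    MulAction.IsPretransitive (Aut FD) (FD.obj (pullback (Φ.map (ι ≫ f)) s)) := by
  refine ⟨fun κ₁ κ₂ => ?_⟩
  have hy : ∀ κ : FD.obj (pullback (Φ.map (ι ≫ f)) s),
      FC.map (ι ≫ f) (e.hom.app c (FD.map (pullback.fst (Φ.map (ι ≫ f)) s) κ)) =
        e.hom.app A (FD.map s t) := by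
    intro κ
    rw [← FunctorToFintypeCat.naturality (Φ ⋙ FD) FC e.hom (ι ≫ f)]
    change e.hom.app A (FD.map (Φ.map (ι ≫ f)) _) = _
    rw [map_fst_sectionFibre FD (Φ.map (ι ≫ f)) s t κ]
  obtain ⟨σ, hσ⟩ := MulAction.exists_smul_eq (Aut FC)
    (e.hom.app c (FD.map (pullback.fst (Φ.map (ι ≫ f)) s) κ₁))
    (e.hom.app c (FD.map (pullback.fst (Φ.map (ι ≫ f)) s) κ₂))
  have hσx : σ ∈ MulAction.stabilizer (Aut FC) (e.hom.app A (FD.map s t)) := by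
    rw [MulAction.mem_stabilizer_iff]
    conv_lhs => rw [← hy κ₁]
    rw [← map_smul_aut₃ FC (ι ≫ f) σ, hσ]
    exact hy κ₂
  obtain ⟨γ, hγ⟩ := hVA hσx
  refine ⟨γ, ext_of_map_fst_snd FD _ s _ _ ?_ (Subsingleton.elim _ _)⟩
  rw [map_smul_aut₃]
  -- compare through the injection `e_c : F_D(Φ c) ↪ F_C(c)`
  have hinj : Function.Injective (e.hom.app c) := by
    intro a a' h
    have h' := congrArg (e.inv.app c) h
    have r : ∀ b, e.inv.app c (e.hom.app c b) = b := fun b =>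
      FintypeCat.hom_inv_id_apply (e.app c) b
    rw [r, r] at h'
    exact h'
  apply hinj
  have h1 : γ • FD.map (pullback.fst (Φ.map (ι ≫ f)) s) κ₁ =
      (pi1Map Φ FD γ) • (show (Φ ⋙ FD).obj c from FD.map (pullback.fst (Φ.map (ι ≫ f)) s) κ₁) :=
    rfl
  rw [h1, ← autMulEquivOfIso_smul_hom_app' e c (pi1Map Φ FD γ), ← hσ]
  exact congrArg (· • _) hγ

/-- **Hence the section fibre of a connected object is connected** (when its fibre is non-empty),
under vertex alignment at the section point. [cite: MochizukiSemiAnbd2006, Rem. 2.2.1 p.24] -/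
theorem isConnected_sectionFibre (Φ : C ⥤ D) (FD : D ⥤ FintypeCat.{w})
    [FiberFunctor FD] (FC : C ⥤ FintypeCat.{w}) [FiberFunctor FC] (e : Φ ⋙ FD ≅ FC)
    {c Y A : C} [IsConnected c] (ι : c ⟶ Y) (f : Y ⟶ A) {T : D} (s : T ⟶ Φ.obj A) (t : FD.obj T)
    [Subsingleton (FD.obj T)]
    (hVA : MulAction.stabilizer (Aut FC) (e.hom.app A (FD.map s t)) ≤
      ((Aut.autMulEquivOfIso e).toMonoidHom.comp (pi1Map Φ FD)).range)
    [Nonempty (FD.obj (pullback (Φ.map (ι ≫ f)) s))] :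
    IsConnected (pullback (Φ.map (ι ≫ f)) s) := by
  haveI := sectionFibre_isPretransitive Φ FD FC e ι f s t hVA
  exact isConnected_of_isPretransitive FD _

/-- **A sub-object of `Φ Y` meeting the section fibre of a connected `c` contains it**: for a
monomorphism `m : W ⟶ Φ Y` and a point `ω ∈ F_D(W)` whose image lies in `Φ c` and over the section
point, the section fibre `Ψ_c → Φ Y` factors through `m` (under vertex alignment at the section point;
lifting lemma `exists_hom_of_map_mem_range` for the connected `Ψ_c`).
[cite: MochizukiSemiAnbd2006, Cor. 2.7(i) p.30] -/
theorem exists_hom_sectionFibre_of_mem_range (Φ : C ⥤ D)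
    (FD : D ⥤ FintypeCat.{w}) [FiberFunctor FD] (FC : C ⥤ FintypeCat.{w}) [FiberFunctor FC]
    (e : Φ ⋙ FD ≅ FC) {c Y A : C} [IsConnected c] (ι : c ⟶ Y) (f : Y ⟶ A) {T : D}
    (s : T ⟶ Φ.obj A) (t : FD.obj T) [Subsingleton (FD.obj T)]
    (hVA : MulAction.stabilizer (Aut FC) (e.hom.app A (FD.map s t)) ≤
      ((Aut.autMulEquivOfIso e).toMonoidHom.comp (pi1Map Φ FD)).range)
    {W : D} (m : W ⟶ Φ.obj Y) [Mono m] (ω : FD.obj W)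
    (hωc : FD.map m ω ∈ Set.range (FD.map (Φ.map ι))) (hωx : FD.map (Φ.map f) (FD.map m ω) = FD.map s t) :
    ∃ k : pullback (Φ.map (ι ≫ f)) s ⟶ W, k ≫ m = pullback.fst (Φ.map (ι ≫ f)) s ≫ Φ.map ι := by
  obtain ⟨κ, hκ⟩ := (mem_range_sectionFibre_iff Φ FD ι f s t (FD.map m ω)).mpr ⟨hωc, hωx⟩
  haveI : Nonempty (FD.obj (pullback (Φ.map (ι ≫ f)) s)) := ⟨κ⟩
  haveI := isConnected_sectionFibre Φ FD FC e ι f s t hVA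
  exact Literature.AnabelianGeometry.SemiGraphs.exists_hom_of_map_mem_range FD
    (pullback.fst (Φ.map (ι ≫ f)) s ≫ Φ.map ι) m ⟨ω, hκ.symm⟩

end SectionFibre

end Literature.AnabelianGeometry.Anabelioids
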